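import Summits.CriticalPhenomena.CardyFormulaZ2.Theorems.StripClusterRates.Negative.SubmultiplicativeOne
import Literature.Probability.Percolation.RSWProofs
import Literature.Probability.Percolation.RSW

/-!
# Stub `stub_sandwichUpper` (A) of line `two-cluster-rate-is-stationary-gap`
# (crux `CardyBoundaryCoulombGas.StripClusterRates`, stmt-CriticalPhenomena-13878)

**A · SANDWICH UPPER.** The super-multiplicative half of the "transfer-matrix order = Cardy order"
sandwich for the one-cluster rate `γ₁(n) = lim_m -log p₁(m,n)/m`, `p₁(m,n) = crossingProb half m n`
(the LR-crossing probability of `[0,m]×[0,n]` at `p = 1/2`): for every width `n ≥ 1`, every limit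
`γ` of `-log p₁(m,n)/m` and every length `m > n`,
`γ ≤ (log 2 - log p₁(m,n))/(m - n)`.

Proof. The gluing inequality `crossingProb_glue_holds` together with the square bound
`p₁(n,n) ≥ 1/2` (`half_le_crossingProb_self crossingProb_half_succ_self_holds`) gives the
width-uniform super-multiplicativity `p₁(m₁,n)·p₁(m₂,n)/2 ≤ p₁(m₁+m₂-n, n)` for `m₁, m₂ ≥ n`
(`sandwichUpper_glue_half`), i.e. `q(k) := p₁(k+n,n)/2` is super-multiplicative in `k`. Iterating,
`q(k)^{j+1} ≤ q((j+1)k)` (`sandwichUpper_blocks_ge`), hence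
`-log p₁((j+1)k+n, n) ≤ (j+1)(log 2 - log p₁(k+n,n))`; dividing by `(j+1)k+n` and letting `j → ∞`
along the subsequence `m = (j+1)k+n` gives `γ ≤ (log 2 - log p₁(k+n,n))/k`
(`sandwichUpper_rate_le_blocks`, the mirror image of `Negative.rateOne_ge_finite`; no appeal to
Fekete's lemma is needed). With `k = m - n` this is the stub.
-/

noncomputable section

namespace Summit.CriticalPhenomena.CardyFormulaZ2.Cruxes.StripClusterRates.TwoClusterRateIsStationaryGap

open Filter Topology
open Literature.Probability.Percolation Literature.Probability.LatticeModels
open Summit.CriticalPhenomena.CardyFormulaZ2.Theorems.StripClusterRates.Negative (pOne pOne_ge)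

/-! ## Width-uniform super-multiplicativity of `p₁` -/

/-- **Width-uniform super-multiplicativity**: `p₁(m₁,n)·p₁(m₂,n)/2 ≤ p₁(m₁+m₂-n, n)` for
`m₁, m₂ ≥ n` (the gluing inequality and `p₁(n,n) ≥ 1/2`). [folklore] -/
theorem sandwichUpper_glue_half {m₁ m₂ n : ℕ} (h₁ : n ≤ m₁) (h₂ : n ≤ m₂) :
    pOne m₁ n * pOne m₂ n / 2 ≤ pOne (m₁ + m₂ - n) n := by
  have hg := crossingProb_glue_holds half m₁ m₂ n h₁ h₂
  have hC := half_le_crossingProb_self crossingProb_half_succ_self_holds n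
  have h0 : 0 ≤ pOne m₁ n * pOne m₂ n :=
    mul_nonneg (crossingProb_mem_Icc _ _ _).1 (crossingProb_mem_Icc _ _ _).1
  calc pOne m₁ n * pOne m₂ n / 2 = pOne m₁ n * pOne m₂ n * (1 / 2) := by ring
    _ ≤ pOne m₁ n * pOne m₂ n * pOne n n := mul_le_mul_of_nonneg_left hC h0
    _ ≤ pOne (m₁ + m₂ - n) n := hg

/-- Iterated super-multiplicativity: `(p₁(k+n,n)/2)^{j+1} ≤ p₁((j+1)k+n, n)/2`. [folklore] -/
theorem sandwichUpper_blocks_ge (n k j : ℕ) :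
    (pOne (k + n) n / 2) ^ (j + 1) ≤ pOne ((j + 1) * k + n) n / 2 := by
  induction j with
  | zero => simp
  | succ j ih =>
    have h := sandwichUpper_glue_half (m₁ := (j + 1) * k + n) (m₂ := k + n) (n := n)
      (Nat.le_add_left n _) (Nat.le_add_left n _)
    have heq : (j + 1) * k + n + (k + n) - n = (j + 1 + 1) * k + n := by
      have : (j + 1 + 1) * k = (j + 1) * k + k := by ring
      omega
    rw [heq] at h
    have hq : 0 ≤ pOne (k + n) n / 2 := div_nonneg (crossingProb_mem_Icc _ _ _).1 (by norm_num)
    calc (pOne (k + n) n / 2) ^ (j + 1 + 1)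
        = (pOne (k + n) n / 2) ^ (j + 1) * (pOne (k + n) n / 2) := by ring
      _ ≤ pOne ((j + 1) * k + n) n / 2 * (pOne (k + n) n / 2) :=
          mul_le_mul_of_nonneg_right ih hq
      _ = pOne ((j + 1) * k + n) n * pOne (k + n) n / 2 / 2 := by ring
      _ ≤ pOne ((j + 1 + 1) * k + n) n / 2 := div_le_div_of_nonneg_right h (by norm_num)

/-! ## The finite-length upper bound on the one-cluster rate -/

/-- The comparison sequence `(j+1)c/((j+1)k+n) → c/k` (`k ≥ 1`). [folklore] -/
theorem sandwichUpper_tendsto_ratio {k : ℕ} (hk : 1 ≤ k) (n : ℕ) (c : ℝ) :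
    Tendsto (fun j : ℕ ↦ (j + 1 : ℝ) * c / ((((j + 1) * k + n : ℕ)) : ℝ)) atTop (𝓝 (c / k)) := by
  have hk0 : (0 : ℝ) < k := by exact_mod_cast hk
  have h1 : Tendsto (fun j : ℕ ↦ c / ((k : ℝ) + n * (1 / ((j : ℝ) + 1)))) atTop
      (𝓝 (c / ((k : ℝ) + n * 0))) :=
    tendsto_const_nhds.div
      (tendsto_const_nhds.add (tendsto_const_nhds.mul tendsto_one_div_add_atTop_nhds_zero_nat))
      (by rw [mul_zero, add_zero]; exact hk0.ne')
  rw [mul_zero, add_zero] at h1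
  refine h1.congr' (Eventually.of_forall fun j ↦ ?_)
  have hj : (0 : ℝ) < (j : ℝ) + 1 := by positivity
  have hden : (0 : ℝ) < ((j : ℝ) + 1) * k + n := by positivity
  push_cast
  field_simp

/-- **Finite-length upper bound on the one-cluster rate** (block form): every limit `γ` of
`-log p₁(m,n)/m` satisfies `γ ≤ (log 2 - log p₁(k+n,n))/k` for every `k ≥ 1`. [folklore] -/
theorem sandwichUpper_rate_le_blocks {n k : ℕ} (hk : 1 ≤ k) {γ : ℝ}
    (h : Tendsto (fun m : ℕ ↦ -Real.log (pOne m n) / (m : ℝ)) atTop (𝓝 γ)) :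
    γ ≤ (Real.log 2 - Real.log (pOne (k + n) n)) / k := by
  have hlim := sandwichUpper_tendsto_ratio hk n (Real.log 2 - Real.log (pOne (k + n) n))
  have hsub : Tendsto (fun j : ℕ ↦ (j + 1) * k + n) atTop atTop := by
    refine tendsto_atTop_mono (fun j ↦ ?_) tendsto_id
    simp only [id]; nlinarith
  refine le_of_tendsto_of_tendsto (h.comp hsub) hlim (Eventually.of_forall fun j ↦ ?_)
  have hp : 0 < pOne (k + n) n := lt_of_lt_of_le (by positivity) (pOne_ge _ n)
  have hpj : 0 < pOne ((j + 1) * k + n) n := lt_of_lt_of_le (by positivity) (pOne_ge _ n)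
  have hlog : -Real.log (pOne ((j + 1) * k + n) n) ≤
      (j + 1 : ℝ) * (Real.log 2 - Real.log (pOne (k + n) n)) := by
    have := Real.log_le_log (by positivity) (sandwichUpper_blocks_ge n k j)
    rw [Real.log_pow, Real.log_div hp.ne' two_ne_zero, Real.log_div hpj.ne' two_ne_zero] at this
    have h2 : 0 ≤ Real.log 2 := Real.log_nonneg one_le_two
    push_cast at this
    linarith
  show -Real.log (pOne ((j + 1) * k + n) n) / ((((j + 1) * k + n : ℕ)) : ℝ) ≤
    (j + 1 : ℝ) * (Real.log 2 - Real.log (pOne (k + n) n)) / ((((j + 1) * k + n : ℕ)) : ℝ)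
  exact div_le_div_of_nonneg_right hlog (by positivity)

/-- **A — `stub_sandwichUpper`.** For every width `n ≥ 1`, every limit `γ` of `-log p₁(m,n)/m`
(`p₁(m,n) = crossingProb half m n`, bond percolation on `ℤ²` at `p = 1/2`) and every length
`m > n`: `γ ≤ (log 2 - log p₁(m,n))/(m - n)` — the super-multiplicative (gluing) half of the
TM-order/Cardy-order sandwich; with `Negative.rateOne_ge_finite` (`γ ≥ -log p₁(m,n)/(m+1)`) it
pins `γ₁(n)` between two finite-length crossing data. [folklore] -/
theorem stub_sandwichUpper :
    ∀ n : ℕ, 1 ≤ n → ∀ γ : ℝ,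
      Tendsto (fun m : ℕ ↦ -Real.log (crossingProb half m n) / (m : ℝ)) atTop (𝓝 γ) →
      ∀ m : ℕ, n < m → γ ≤ (Real.log 2 - Real.log (crossingProb half m n)) / ((m : ℝ) - n) := by
  intro n _ γ hγ m hm
  obtain ⟨k, rfl⟩ : ∃ k, m = k + n := ⟨m - n, (Nat.sub_add_cancel hm.le).symm⟩
  have hk : 1 ≤ k := by omega
  have hcast : ((k + n : ℕ) : ℝ) - n = k := by push_cast; ring
  rw [hcast]
  exact sandwichUpper_rate_le_blocks hk hγ

end Summit.CriticalPhenomena.CardyFormulaZ2.Cruxes.StripClusterRates.TwoClusterRateIsStationaryGap
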